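import Summits.RiemannHypothesis.RiemannHypothesis.Theorems.WeilColumnThetaMellinTransform
import HarnessLib

/-!
# `‖T̂(s)‖ ≤ W/‖s − ½‖` for a `C¹` left tail with EXPONENTIAL decay (PR input: the truncation error `E_R = G₀(1−ψ_R)`)

WEIL column (LADDER-RH, W-P(P2); tier-1 `ThetaCertificateSound`, item PR of THETA-ASSIGN v1.0 §3). For a `C¹` function `T` with
`T = 0` on `[b, ∞)` (`b ≤ 0`) and `‖T(x)‖, ‖T′(x)‖ ≤ C·e^{κx}` for `x ≤ b` (`κ > ½`): for every `s ≠ ½` with `Re s ≥ 0`,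
**`‖weilMellin T s‖ ≤ (C·e^{(κ−½)b}/(κ−½)) / ‖s − ½‖`** (`norm_weilMellin_le_of_exp_decay`) — p412019's
`norm_weilMellin_le_of_deriv` with the integrals made explicit. With `b = −R`, `κ = m + ½` the constant is `C·e^{−mR}/m → 0`:
this is why the «bracket» of the (P_R) assembly vanishes as `R → ∞` (WEIL-THEORY-R3 v1.3 §3⁗). RH-free; nothing here bears on RH.
-/

set_option linter.dupNamespace false

noncomputable section

open MeasureTheory Set Complex Filter
open scoped Real Topology
open Literature.NumberTheory.LFunctions

namespace Summit.RiemannHypothesis.RiemannHypothesis.Theorems.WeilColumn.ThetaMellin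

/-- A function vanishing on `[b, ∞)` has derivative `0` on `(b, ∞)`. [folklore] -/
theorem deriv_eq_zero_of_eq_zero_Ici {T T' : ℝ → ℂ} (hT : ∀ x, HasDerivAt T (T' x) x) {b : ℝ}
    (hzero : ∀ x, b ≤ x → T x = 0) {x : ℝ} (hx : b < x) : T' x = 0 := by
  have hconst : HasDerivAt T 0 x := by
    have hev : T =ᶠ[𝓝 x] fun _ => (0 : ℂ) := by
      filter_upwards [Ioi_mem_nhds hx] with y hy using hzero y (le_of_lt hy)
    exact (hasDerivAt_const x (0 : ℂ)).congr_of_eventuallyEq hev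
  exact (hT x).unique hconst

/-- Integrability of `F(t)·e^{(s−½)t}` for a left tail with exponential decay: `F = 0` on `(b, ∞)`, `‖F‖ ≤ C e^{κt}` on `(−∞, b]`,
`κ + Re s − ½ > 0`. [folklore] -/
theorem integrable_mul_cexp_of_exp_decay {F : ℝ → ℂ} (hF : Continuous F) {b C κ : ℝ} (hzero : ∀ x, b < x → F x = 0)
    (hbd : ∀ x, x ≤ b → ‖F x‖ ≤ C * Real.exp (κ * x)) {s : ℂ} (hpos : 0 < κ + (s.re - 1 / 2)) :
    Integrable (fun t : ℝ => F t * cexp ((s - 1 / 2) * t)) := by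
  set a : ℝ := κ + (s.re - 1 / 2) with ha
  have hg : Integrable (Set.indicator (Iic b) fun t : ℝ => C * Real.exp (a * t)) :=
    (integrable_indicator_iff measurableSet_Iic).mpr ((integrableOn_exp_mul_Iic hpos b).const_mul C)
  refine hg.mono' ((hF.mul (by fun_prop)).aestronglyMeasurable) (Eventually.of_forall fun t => ?_)
  by_cases ht : t ≤ b
  · rw [indicator_of_mem (mem_Iic.mpr ht), norm_mul, Complex.norm_exp]
    have hre : ((s - 1 / 2) * (t : ℂ)).re = (s.re - 1 / 2) * t := by simp [sub_re, mul_re]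
    rw [hre]
    calc ‖F t‖ * Real.exp ((s.re - 1 / 2) * t) ≤ C * Real.exp (κ * t) * Real.exp ((s.re - 1 / 2) * t) := by
          gcongr; exact hbd t ht
      _ = C * Real.exp (a * t) := by rw [ha, mul_assoc, ← Real.exp_add]; ring_nf
  · rw [indicator_of_notMem (by simpa using ht), hzero t (not_le.mp ht), zero_mul, norm_zero]

/-- **`‖T̂(s)‖ ≤ (C·e^{(κ−½)b}/(κ−½))/‖s − ½‖` for a `C¹` left tail with exponential decay** (`T = 0` on `[b,∞)`, `b ≤ 0`,
`‖T‖, ‖T′‖ ≤ C e^{κx}` on `(−∞, b]`, `κ > ½`, `Re s ≥ 0`, `s ≠ ½`). [folklore] -/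
theorem norm_weilMellin_le_of_exp_decay {T T' : ℝ → ℂ} (hT : ∀ x, HasDerivAt T (T' x) x) (hT'c : Continuous T')
    {b C κ : ℝ} (hκ : 1 / 2 < κ) (hC : 0 ≤ C) (hb : b ≤ 0) (hzero : ∀ x, b ≤ x → T x = 0)
    (h0 : ∀ x, x ≤ b → ‖T x‖ ≤ C * Real.exp (κ * x)) (h1 : ∀ x, x ≤ b → ‖T' x‖ ≤ C * Real.exp (κ * x))
    {s : ℂ} (hs0 : 0 ≤ s.re) (hs : s ≠ 1 / 2) :
    ‖weilMellin T s‖ ≤ (C * Real.exp ((κ - 1 / 2) * b) / (κ - 1 / 2)) / ‖s - 1 / 2‖ := by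
  have hTc : Continuous T := continuous_iff_continuousAt.mpr fun x => (hT x).continuousAt
  set a : ℝ := κ + (s.re - 1 / 2) with ha
  have ha0 : κ - 1 / 2 ≤ a := by rw [ha]; linarith
  have hapos : 0 < a := lt_of_lt_of_le (by linarith) ha0
  have hzero' : ∀ x, b < x → T' x = 0 := fun x hx => deriv_eq_zero_of_eq_zero_Ici hT hzero hx
  have hI1 := integrable_mul_cexp_of_exp_decay hTc (fun x hx => hzero x hx.le) h0 (s := s) hapos
  have hI2 := integrable_mul_cexp_of_exp_decay hT'c hzero' h1 (s := s) hapos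
  refine (norm_weilMellin_le_of_deriv hT hs hI1 hI2).trans ?_
  have hwpos : 0 < ‖s - 1 / 2‖ := norm_pos_iff.mpr (sub_ne_zero.mpr hs)
  rw [div_le_div_iff_of_pos_right hwpos]
  -- bound the derivative integral by the exponential majorant
  have hg : Integrable (Set.indicator (Iic b) fun t : ℝ => C * Real.exp (a * t)) :=
    (integrable_indicator_iff measurableSet_Iic).mpr ((integrableOn_exp_mul_Iic hapos b).const_mul C)
  have hle : ∀ t : ℝ, ‖T' t‖ * Real.exp ((s.re - 1 / 2) * t) ≤ Set.indicator (Iic b) (fun t : ℝ => C * Real.exp (a * t)) t := by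
    intro t
    by_cases ht : t ≤ b
    · rw [indicator_of_mem (mem_Iic.mpr ht)]
      calc ‖T' t‖ * Real.exp ((s.re - 1 / 2) * t) ≤ C * Real.exp (κ * t) * Real.exp ((s.re - 1 / 2) * t) := by
            gcongr; exact h1 t ht
        _ = C * Real.exp (a * t) := by rw [ha, mul_assoc, ← Real.exp_add]; ring_nf
    · rw [indicator_of_notMem (by simpa using ht), hzero' t (not_le.mp ht), norm_zero, zero_mul]
  have hint : ∫ t : ℝ, ‖T' t‖ * Real.exp ((s.re - 1 / 2) * t) ≤ ∫ t : ℝ, Set.indicator (Iic b) (fun t : ℝ => C * Real.exp (a * t)) t := by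
    refine integral_mono_of_nonneg (Eventually.of_forall fun t => by positivity) hg (Eventually.of_forall hle)
  refine hint.trans ?_
  rw [integral_indicator measurableSet_Iic, integral_const_mul, integral_exp_mul_Iic hapos]
  -- C e^{ab}/a ≤ C e^{(κ−½)b}/(κ−½)
  rw [← mul_div_assoc]
  have hexp : Real.exp (a * b) ≤ Real.exp ((κ - 1 / 2) * b) := Real.exp_le_exp.mpr (by nlinarith)
  calc C * Real.exp (a * b) / a ≤ C * Real.exp ((κ - 1 / 2) * b) / a := by gcongr
    _ ≤ C * Real.exp ((κ - 1 / 2) * b) / (κ - 1 / 2) := by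
        apply div_le_div_of_nonneg_left (by positivity) (by linarith) ha0

end Summit.RiemannHypothesis.RiemannHypothesis.Theorems.WeilColumn.ThetaMellin
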